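import Summits.ValiantsHypothesis.ValiantsHypothesis.Theorems.DefinabilityGapSparsityRung
import HarnessLib

/-!
# DefinabilityGap — the PEELING rung: what the zero-out induction really reaches (support geometry, not sparsity)

Route `route-ValiantsHypothesis-DefinabilityGap` (decomp-valiant cycle 1, lens 5). Census cells W5 / W19 (size road of the
residual `KIPlantedHitting`, stmt-ValiantsHypothesis-23547) and F4 / W10 (`KIPlantedHittingRO`, stmt-ValiantsHypothesis-23704).

The zero-out induction of `DefinabilityGapSparsityRung` pays two zeros per block PER LEVEL, and a level is a PEELING STEP:
pass from `D` to its SURVIVORS along a block `c` — the monomials of least `z_c`-degree, divided by that power of `z_c`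
(`survivors`). It never needed the number of monomials, only the number of levels until at most two monomials are left.

* `kiPerZ_hits_peel` / **`kiPer_hits_of_peel`** (`m ≥ 3`): if some sequence of `k` peeling steps (`peel l`, `l` a list of
  `k` blocks) leaves at most two monomials of `D ≠ 0`, and `2k + 2 ≤ m`, then `G_m` hits `D` — NO bound on the number of
  monomials, the degree or the supports of `D`.
* `kiPer_hits_of_few_minimisers` (`m ≥ 4`): if along some block `c` at most two monomials of `D` have the least
  `z_c`-degree, `G_m` hits `D`; e.g. `kiPer_hits_monomial_add_X_mul`: **`G_m` hits `a·z^κ + z_c·E` for EVERY polynomial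
  `E`** (`a ≠ 0`, `z_c ∤ z^κ`) — hitting is insensitive to arbitrary "noise" of positive `z_c`-order, and by the main
  theorem to `⌊(m−2)/2⌋` nested layers of such noise.
* The sparsity rung (`≤ ⌊m/2⌋ + 1` monomials) is the crude corollary "every level removes a monomial".

Honest ceiling of the METHOD, now exactly: coordinate-peeling depth `≤ ⌊(m−2)/2⌋`. Supports all of whose iterated
coordinate-minimal faces keep `≥ 3` points for that many rounds (e.g. large symmetric or multilinear supports) are out of
reach of zeroing; lifting it needs a degradation that charges fewer than two cells per level to the surviving blocks, or
specialisation to generic constants with an irreducibility theorem for partially specialised permanents. 0 sorry.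
-/

noncomputable section

open MvPolynomial
open Literature.Computability.AlgebraicComplexity Literature.Computability.MetaComplexity

namespace Summit.ValiantsHypothesis.ValiantsHypothesis.Theorems.DefinabilityGapPeelingRung

open Summit.ValiantsHypothesis.ValiantsHypothesis.Theorems.DefinabilityGapAffineRung
open Summit.ValiantsHypothesis.ValiantsHypothesis.Theorems.DefinabilityGapPatternPermanent
open Summit.ValiantsHypothesis.ValiantsHypothesis.Theorems.DefinabilityGapZeroedBlocks
open Summit.ValiantsHypothesis.ValiantsHypothesis.Theorems.DefinabilityGapSparsityRung

/-! ## 1. Peeling a polynomial along a variable -/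

section Peel

variable {σ : Type*} {R : Type*} [CommSemiring R]

/-- The least exponent of `z_c` among the monomials of `D` (`0` for `D = 0`). [this file] -/
def minExp (c : σ) (D : MvPolynomial σ R) : ℕ :=
  if h : D.support.Nonempty then D.support.inf' h (fun κ => κ c) else 0

/-- `minExp` is a lower bound. [this file] -/
theorem minExp_le (c : σ) {D : MvPolynomial σ R} {κ : σ →₀ ℕ} (hκ : κ ∈ D.support) : minExp c D ≤ κ c := by
  rw [minExp, dif_pos ⟨κ, hκ⟩]
  exact Finset.inf'_le _ hκ

/-- `minExp` is attained. [this file] -/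
theorem exists_eq_minExp (c : σ) {D : MvPolynomial σ R} (hD : D.support.Nonempty) :
    ∃ κ ∈ D.support, κ c = minExp c D := by
  rw [minExp, dif_pos hD]
  obtain ⟨κ, hκ, h⟩ := Finset.exists_mem_eq_inf' hD (fun κ => κ c)
  exact ⟨κ, hκ, h.symm⟩

/-- Every exponent of `D` dominates `z_c^{minExp}`. [this file] -/
theorem single_minExp_le (c : σ) {D : MvPolynomial σ R} {κ : σ →₀ ℕ} (hκ : κ ∈ D.support) :
    Finsupp.single c (minExp c D) ≤ κ :=
  Finsupp.single_le_iff.2 (minExp_le c hκ)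

/-- The SURVIVORS of peeling `D` along `c`: the monomials of least `z_c`-degree, divided by that power of `z_c`. [this file] -/
def survivors (c : σ) (D : MvPolynomial σ R) : MvPolynomial σ R :=
  part (MvPolynomial.divMonomial D (Finsupp.single c (minExp c D))) (fun κ => κ c = 0)

/-- Support of the survivors. [this file] -/
theorem mem_support_survivors (c : σ) (D : MvPolynomial σ R) (κ : σ →₀ ℕ) :
    κ ∈ (survivors c D).support ↔ κ c = 0 ∧ Finsupp.single c (minExp c D) + κ ∈ D.support := by
  rw [survivors, support_part, Finset.mem_filter, mem_support_iff, coeff_divMonomial, ← mem_support_iff, and_comm]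

/-- `D = z_c^{minExp} · (D / z_c^{minExp})`. [this file] -/
theorem eq_monomial_mul (c : σ) (D : MvPolynomial σ R) :
    D = monomial (Finsupp.single c (minExp c D)) 1 *
      MvPolynomial.divMonomial D (Finsupp.single c (minExp c D)) :=
  eq_monomial_mul_divMonomial D _ fun _ hκ => single_minExp_le c hκ

/-- The quotient splits into the survivors and the monomials still divisible by `z_c`. [this file] -/
theorem divMonomial_eq_survivors_add (c : σ) (D : MvPolynomial σ R) :
    MvPolynomial.divMonomial D (Finsupp.single c (minExp c D)) =
      survivors c D + part (MvPolynomial.divMonomial D (Finsupp.single c (minExp c D))) (fun κ => ¬ κ c = 0) :=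
  (part_add_part_not _ _).symm

/-- A nonzero polynomial has survivors. [this file] -/
theorem survivors_ne_zero (c : σ) {D : MvPolynomial σ R} (hD : D ≠ 0) : survivors c D ≠ 0 := by
  obtain ⟨κ, hκ, hκc⟩ := exists_eq_minExp c
    (Finset.nonempty_of_ne_empty fun h => hD (MvPolynomial.support_eq_empty.1 h))
  have hmem : κ - Finsupp.single c (minExp c D) ∈ (survivors c D).support := by
    rw [mem_support_survivors, add_tsub_cancel_of_le (single_minExp_le c hκ), Finsupp.tsub_apply,
      Finsupp.single_eq_same]
    exact ⟨by omega, hκ⟩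
  intro h
  rw [h, support_zero] at hmem
  exact Finset.notMem_empty _ hmem

/-- The survivors are no more than the minimisers. [this file] -/
theorem card_support_survivors_le (c : σ) (D : MvPolynomial σ R) :
    (survivors c D).support.card ≤ (D.support.filter fun κ => κ c = minExp c D).card := by
  refine Finset.card_le_card_of_injOn (fun κ => Finsupp.single c (minExp c D) + κ) (fun κ hκ => ?_)
    (add_right_injective _).injOn
  have hκ' := (mem_support_survivors c D κ).1 hκ
  exact Finset.mem_filter.2 ⟨hκ'.2, by rw [Finsupp.add_apply, Finsupp.single_eq_same, hκ'.1, add_zero]⟩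

/-- Iterated peeling along a list of variables. [this file] -/
def peel : List σ → MvPolynomial σ R → MvPolynomial σ R
  | [], D => D
  | c :: l, D => peel l (survivors c D)

/-- `peel []`. [this file] -/
@[simp] theorem peel_nil (D : MvPolynomial σ R) : peel [] D = D := rfl

/-- `peel (c :: l)`. [this file] -/
@[simp] theorem peel_cons (c : σ) (l : List σ) (D : MvPolynomial σ R) :
    peel (c :: l) D = peel l (survivors c D) := rfl

end Peel

/-! ## 2. One peeling step under the degraded generators -/

variable {m : ℕ}

/-- **Peeling step.** If `D(Q^F) = 0` and block `c` (if read) has a small pattern, then the survivors along `c`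
annihilate the generator with the cells of `c` zeroed: `survivors_c(D)(Q^{F ∪ cells c}) = 0`. [this file] -/
theorem bind₁_kiPerZ_survivors (hm : 3 ≤ m) {F : Finset (Fin (qOf m) × Fin (qOf m))}
    {D : MvPolynomial (Fin 3 → Fin (qOf m)) ℂ} (c : Fin 3 → Fin (qOf m))
    (hc : ∀ κ ∈ D.support, c ∈ κ.support → (patOf m F c).card + 2 ≤ m)
    (h0 : bind₁ (kiPerZ m F) D = 0) : bind₁ (kiPerZ m (F ∪ cells m c)) (survivors c D) = 0 := by
  classical
  -- cancel `z_c^{minExp}`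
  have h0' : bind₁ (kiPerZ m F) (MvPolynomial.divMonomial D (Finsupp.single c (minExp c D))) = 0 := by
    rw [eq_monomial_mul c D, map_mul, bind₁_monomial, C_1, one_mul] at h0
    rcases mul_eq_zero.1 h0 with h1 | h1
    · exfalso
      refine prod_kiPerZ_pow_ne_zero (Finsupp.single c (minExp c D)) (fun i hi => ?_) h1
      rw [Finsupp.mem_support_iff, Finsupp.single_apply] at hi
      split_ifs at hi with hic
      · rw [← hic]
        have hD : D.support.Nonempty := by
          by_contra hne
          rw [minExp, dif_neg hne] at hi
          exact hi rfl
        obtain ⟨κ, hκ, hκc⟩ := exists_eq_minExp c hD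
        exact hc κ hκ (Finsupp.mem_support_iff.2 (by rw [hκc]; exact hi))
      · exact absurd rfl hi
    · exact h1
  -- zero out the cells of `c`
  have h0'' : bind₁ (kiPerZ m (F ∪ cells m c))
      (MvPolynomial.divMonomial D (Finsupp.single c (minExp c D))) = 0 := by
    have := congrArg (zeroOut m (cells m c)) h0'
    rw [map_zero, zeroOut_bind₁] at this
    simp_rw [zeroOut_kiPerZ] at this
    exact this
  -- the monomials still divisible by `z_c` die
  have hkill : bind₁ (kiPerZ m (F ∪ cells m c))
      (part (MvPolynomial.divMonomial D (Finsupp.single c (minExp c D))) fun κ => ¬ κ c = 0) = 0 := by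
    rw [part, map_sum]
    refine Finset.sum_eq_zero fun κ hκ => ?_
    rw [Finset.mem_filter] at hκ
    rw [bind₁_monomial]
    refine mul_eq_zero_of_right _ (Finset.prod_eq_zero (Finsupp.mem_support_iff.2 hκ.2) ?_)
    rw [kiPerZ_eq_zero (by omega) Finset.subset_union_right, zero_pow hκ.2]
  rw [divMonomial_eq_survivors_add c D, map_add, hkill, add_zero] at h0''
  exact h0''

/-! ## 3. The peeling theorem -/

/-- **Zero-out induction along a peeling sequence.** For `m ≥ 3`: if `peel l D` has at most two monomials, every block read
by `D` has seen at most `m − 2 − 2·|l|` zeros of `F`, and `D(Q^F) = 0`, then `D = 0`. [this file] -/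
theorem kiPerZ_hits_peel (hm : 3 ≤ m) :
    ∀ (l : List (Fin 3 → Fin (qOf m))) (F : Finset (Fin (qOf m) × Fin (qOf m)))
      (D : MvPolynomial (Fin 3 → Fin (qOf m)) ℂ),
      (peel l D).support.card ≤ 2 →
      (∀ κ ∈ D.support, ∀ c ∈ κ.support, (patOf m F c).card + 2 * l.length + 2 ≤ m) →
      bind₁ (kiPerZ m F) D = 0 → D = 0 := by
  classical
  intro l
  induction l with
  | nil =>
    intro F D h2 hb h0
    have hs : D.support.card ≤ 2 := h2
    exact kiPerZ_hits_sparse hm D.support.card F D rfl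
      (fun κ hκ c hc => by have := hb κ hκ c hc; simp only [List.length_nil, mul_zero] at this; omega) h0
  | cons c l ih =>
    intro F D h2 hb h0
    by_contra hD
    have hlen : (c :: l).length = l.length + 1 := rfl
    have hsurv := bind₁_kiPerZ_survivors hm c (fun κ hκ hcκ => by have := hb κ hκ c hcκ; omega) h0
    have hb' : ∀ κ ∈ (survivors c D).support, ∀ i ∈ κ.support,
        (patOf m (F ∪ cells m c) i).card + 2 * l.length + 2 ≤ m := by
      intro κ hκ i hi
      rw [mem_support_survivors] at hκ
      have hic : i ≠ c := fun h => by
        rw [h] at hi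
        exact (Finsupp.mem_support_iff.1 hi) hκ.1
      have hi' : i ∈ (Finsupp.single c (minExp c D) + κ).support := by
        rw [Finsupp.mem_support_iff, Finsupp.add_apply]
        have := Finsupp.mem_support_iff.1 hi
        omega
      have h1 := hb _ hκ.2 i hi'
      have h3 := card_patOf_union_cells_le hic F
      rw [hlen] at h1
      omega
    rw [peel_cons] at h2
    exact survivors_ne_zero c hD (ih (F ∪ cells m c) (survivors c D) h2 hb' hsurv)

/-! ## 4. The peeling rung for `G_m` -/

/-- **PEELING RUNG.** For `m ≥ 3` and `D ≠ 0`: if `k` peeling steps leave at most two monomials and `2k + 2 ≤ m`, then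
`G_m` hits `D` — whatever the number of monomials, degree or supports of `D`. [this file] -/
theorem kiPer_hits_of_peel (hm : 3 ≤ m) {D : MvPolynomial (Fin 3 → Fin (qOf m)) ℂ} (hD : D ≠ 0)
    (l : List (Fin 3 → Fin (qOf m))) (hl : (peel l D).support.card ≤ 2) (hlen : 2 * l.length + 2 ≤ m) :
    bind₁ (kiPer m) D ≠ 0 := by
  intro h0
  apply hD
  refine kiPerZ_hits_peel hm l ∅ D hl (fun κ _ c _ => ?_) ?_
  · rw [patOf_empty, Finset.card_empty]
    omega
  · have : kiPerZ m ∅ = kiPer m := funext kiPerZ_empty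
    rw [this]
    exact h0

/-- **Few minimisers.** For `m ≥ 4`: if along some block `c` at most two monomials of `D ≠ 0` have the least `z_c`-degree,
then `G_m` hits `D`. [this file] -/
theorem kiPer_hits_of_few_minimisers (hm : 4 ≤ m) {D : MvPolynomial (Fin 3 → Fin (qOf m)) ℂ} (hD : D ≠ 0)
    (c : Fin 3 → Fin (qOf m)) (hc : (D.support.filter fun κ => κ c = minExp c D).card ≤ 2) :
    bind₁ (kiPer m) D ≠ 0 := by
  classical
  exact kiPer_hits_of_peel (by omega) hD [c] ((card_support_survivors_le c D).trans hc)
    (by simp only [List.length_singleton]; omega)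

/-- **Noise insensitivity.** For `m ≥ 4`, `a ≠ 0` and `z_c ∤ z^κ`: `G_m` hits `a·z^κ + z_c·E` for EVERY polynomial `E`.
[this file] -/
theorem kiPer_hits_monomial_add_X_mul (hm : 4 ≤ m) (κ : (Fin 3 → Fin (qOf m)) →₀ ℕ) {a : ℂ} (ha : a ≠ 0)
    (c : Fin 3 → Fin (qOf m)) (hκc : κ c = 0) (E : MvPolynomial (Fin 3 → Fin (qOf m)) ℂ) :
    bind₁ (kiPer m) (monomial κ a + X c * E) ≠ 0 := by
  classical
  have hcoeff : ∀ κ' : (Fin 3 → Fin (qOf m)) →₀ ℕ, κ' c = 0 →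
      coeff κ' (monomial κ a + X c * E) = if κ = κ' then a else 0 := by
    intro κ' hκ'
    have hc' : c ∉ κ'.support := by
      rw [Finsupp.mem_support_iff]
      omega
    rw [coeff_add, coeff_monomial, coeff_X_mul', if_neg hc', add_zero]
  have hκmem : κ ∈ (monomial κ a + X c * E).support := by
    rw [mem_support_iff, hcoeff κ hκc, if_pos rfl]
    exact ha
  have hD : monomial κ a + X c * E ≠ 0 := fun h => by
    rw [h, support_zero] at hκmem
    exact Finset.notMem_empty _ hκmem
  have hmin : minExp c (monomial κ a + X c * E) = 0 := by
    have := minExp_le c hκmem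
    omega
  refine kiPer_hits_of_few_minimisers hm hD c ?_
  rw [hmin]
  refine (Finset.card_le_card (t := {κ}) fun κ' hκ' => ?_).trans (by rw [Finset.card_singleton]; omega)
  rw [Finset.mem_filter, mem_support_iff] at hκ'
  rw [hcoeff κ' hκ'.2] at hκ'
  rw [Finset.mem_singleton]
  by_contra hne
  exact hκ'.1 (if_neg (Ne.symm hne))

end Summit.ValiantsHypothesis.ValiantsHypothesis.Theorems.DefinabilityGapPeelingRung
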